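import Mathlib
import Summits.ResolutionOfSingularities.ResolutionOfSingularities.Theorems.WildQuotientsWildQuotientResolutionToricExitTranslationFixed

/-!
# V3U chart a, steps (ii)+(iii): fixed points of the root-chart action `σ_U` lie in `k[N, c′, xᵢ (i ≠ b, c)]`

(crux stmt-ResolutionOfSingularities-15640 `WildQuotients.WildQuotientResolution`, line `Sketch`,
sector `|G| = p`; programme V3U «toric exit» of `L/w45c/CHAIN.md` v5 §4 row stub-1, steps
(ii)+(iii) of C2 `chartA_fixedPoints_eq`; [OURS · L1 W4.5c] — NOT a statement of any manuscript;
replaces the role of no printed item.)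

The root-chart action `σ_U` of the Jordan block (`ρ = x_a ↦ ρ`, `β = x_b ↦ β + ρ`,
`x_c ↦ x_c + ρβ`, passengers fixed) is CONJUGATE, by the `k`-algebra automorphism
`ψ : x_c ↦ c′ = x_c − ½(β² − ρβ)` (others fixed; `p ≠ 2`), to the pure translation `τ : β ↦ β + ρ`
(`rootChart_conj`: `ψ ∘ τ = σ_U ∘ ψ`), because `σ_U c′ = c′`. Hence
(`mem_adjoin_of_rootChart_eq`) every `σ_U`-fixed `f` lies in
`ψ(k[N, xᵢ (i ≠ b)]) = k[N, c′, xᵢ (i ≠ b, c)]`, `N = β^p − ρ^{p−1} β`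
(`ToricExit.mem_adjoin_of_translate_eq`, p488136). Conversely `N` and `c′` are `σ_U`-fixed
(`rootChart_artinSchreier`, `rootChart_cPrime`).
-/

-- single-problem summit: the doubled namespace component `ResolutionOfSingularities` is forced
set_option linter.dupNamespace false

noncomputable section

open MvPolynomial

namespace Summit.ResolutionOfSingularities.ResolutionOfSingularities.Theorems.WildQuotientResolution.ToricExit

variable (k : Type) [Field k] (n : ℕ)
  (σU : MvPolynomial (Fin n) k ≃ₐ[k] MvPolynomial (Fin n) k) (a b c : Fin n)
  (hab : a ≠ b) (hbc : b ≠ c) (hac : a ≠ c)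
  (hb : σU (X b) = X b + X a) (hc : σU (X c) = X c + X a * X b)
  (hσ : ∀ i, i ≠ b → i ≠ c → σU (X i) = X i)

include hab hac hb hσ in
/-- **`N = β^p − ρ^{p−1} β` is `σ_U`-invariant** in characteristic `p` (`(β + ρ)^p = β^p + ρ^p`).
[folklore: Artin–Schreier] -/
theorem rootChart_artinSchreier (p : ℕ) (hp : p.Prime) [CharP k p] :
    σU (X b ^ p - X a ^ (p - 1) * X b) = X b ^ p - X a ^ (p - 1) * X b := by
  haveI : Fact p.Prime := ⟨hp⟩
  have ha : σU (X a) = X a := hσ a hab hac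
  have hp1 : p - 1 + 1 = p := Nat.succ_pred_eq_of_pos hp.pos
  rw [map_sub, map_pow, map_mul, map_pow, hb, ha, add_pow_char, mul_add]
  conv_lhs => rw [← pow_succ, hp1]
  ring

include hab hac hb hc hσ in
/-- **`c′ = x_c − ½(β² − ρβ)` is `σ_U`-invariant** (`p ≠ 2`). [folklore] -/
theorem rootChart_cPrime (h2 : (2 : k) ≠ 0) :
    σU (X c - C (2⁻¹ : k) * (X b ^ 2 - X a * X b)) = X c - C (2⁻¹ : k) * (X b ^ 2 - X a * X b) := by
  have ha : σU (X a) = X a := hσ a hab hac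
  have hC : σU (C (2⁻¹ : k)) = C (2⁻¹ : k) := σU.commutes (2⁻¹ : k)
  have h2C : (2 : MvPolynomial (Fin n) k) * C (2⁻¹ : k) = 1 := by
    rw [← map_ofNat C 2, ← map_mul, mul_inv_cancel₀ h2, map_one]
  rw [map_sub, map_mul, map_sub, map_pow, map_mul, hC, hb, ha, hc]
  linear_combination (-(X a * X b) : MvPolynomial (Fin n) k) * h2C

include hab hbc hac hb hc hσ in
/-- **The conjugation**: with `τ` the pure translation (`β ↦ β + ρ`, all other variables fixed)
and `ψ` the substitution `x_c ↦ c′ = x_c − ½(β² − ρβ)` (other variables fixed), one has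
`ψ (τ y) = σ_U (ψ y)` for all `y` (check on the variables; the case `x_c` is `σ_U c′ = c′`).
[folklore] -/
theorem rootChart_conj (h2 : (2 : k) ≠ 0) (y : MvPolynomial (Fin n) k) :
    aeval (fun i : Fin n => if i = c then X c - C (2⁻¹ : k) * (X b ^ 2 - X a * X b)
        else (X i : MvPolynomial (Fin n) k))
      (aeval (fun i : Fin n => if i = b then X b + X a else (X i : MvPolynomial (Fin n) k)) y) =
    σU (aeval (fun i : Fin n => if i = c then X c - C (2⁻¹ : k) * (X b ^ 2 - X a * X b)
        else (X i : MvPolynomial (Fin n) k)) y) := by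
  classical
  set ψf : MvPolynomial (Fin n) k →ₐ[k] MvPolynomial (Fin n) k :=
    aeval (fun i : Fin n => if i = c then X c - C (2⁻¹ : k) * (X b ^ 2 - X a * X b)
      else (X i : MvPolynomial (Fin n) k)) with hψf
  set τ : MvPolynomial (Fin n) k →ₐ[k] MvPolynomial (Fin n) k :=
    aeval (fun i : Fin n => if i = b then X b + X a else (X i : MvPolynomial (Fin n) k)) with hτ
  have ha : σU (X a) = X a := hσ a hab hac
  have hψa : ψf (X a) = X a := by rw [hψf, aeval_X, if_neg hac]
  have hψb : ψf (X b) = X b := by rw [hψf, aeval_X, if_neg hbc]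
  have hψc : ψf (X c) = X c - C (2⁻¹ : k) * (X b ^ 2 - X a * X b) := by rw [hψf, aeval_X, if_pos rfl]
  have key : ψf.comp τ = (σU : MvPolynomial (Fin n) k →ₐ[k] MvPolynomial (Fin n) k).comp ψf := by
    refine MvPolynomial.algHom_ext fun i => ?_
    change ψf (τ (X i)) = σU (ψf (X i))
    rw [hτ, aeval_X]
    by_cases hib : i = b
    · subst hib
      rw [if_pos rfl, map_add, hψa, hψb, hb]
    · rw [if_neg hib]
      by_cases hic : i = c
      · subst hic
        rw [hψc, rootChart_cPrime k n σU a b i hab hac hb hc hσ h2]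
      · rw [hψf, aeval_X, if_neg hic, hσ i hib hic]
  have h := congrArg (fun φ : MvPolynomial (Fin n) k →ₐ[k] MvPolynomial (Fin n) k => φ y) key
  exact h

include hab hbc hac hb hc hσ in
/-- **Fixed points of the root-chart action lie in `k[N, c′, xᵢ (i ≠ b, c)]`** (`p ≥ 3`):
`f = ψ g` with `g = ψ⁻¹ f` fixed by the pure translation (`rootChart_conj`), so
`g ∈ k[N, xᵢ (i ≠ b)]` (`mem_adjoin_of_translate_eq`) and `f ∈ ψ(k[N, xᵢ (i ≠ b)])`, whose
generators `ψ N = N`, `ψ x_c = c′`, `ψ xᵢ = xᵢ` lie in the target. [OURS · L1 W4.5c] -/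
theorem mem_adjoin_of_rootChart_eq (p : ℕ) (hp : p.Prime) (hp3 : 3 ≤ p) [CharP k p]
    (f : MvPolynomial (Fin n) k) (hf : σU f = f) :
    f ∈ Algebra.adjoin k (({X b ^ p - X a ^ (p - 1) * X b,
        X c - C (2⁻¹ : k) * (X b ^ 2 - X a * X b)} : Set (MvPolynomial (Fin n) k)) ∪
      ((fun i => X i) '' {i | i ≠ b ∧ i ≠ c})) := by
  classical
  -- `2 ≠ 0` in `k`
  have h2 : (2 : k) ≠ 0 := by
    intro h
    have hdvd : p ∣ 2 := (CharP.cast_eq_zero_iff k p 2).mp (by exact_mod_cast h)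
    have := Nat.le_of_dvd two_pos hdvd
    omega
  set T := Algebra.adjoin k (({X b ^ p - X a ^ (p - 1) * X b,
      X c - C (2⁻¹ : k) * (X b ^ 2 - X a * X b)} : Set (MvPolynomial (Fin n) k)) ∪
    ((fun i => X i) '' {i | i ≠ b ∧ i ≠ c})) with hT
  set ψf : MvPolynomial (Fin n) k →ₐ[k] MvPolynomial (Fin n) k :=
    aeval (fun i : Fin n => if i = c then X c - C (2⁻¹ : k) * (X b ^ 2 - X a * X b)
      else (X i : MvPolynomial (Fin n) k)) with hψf
  set ψg : MvPolynomial (Fin n) k →ₐ[k] MvPolynomial (Fin n) k :=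
    aeval (fun i : Fin n => if i = c then X c + C (2⁻¹ : k) * (X b ^ 2 - X a * X b)
      else (X i : MvPolynomial (Fin n) k)) with hψg
  set τ : MvPolynomial (Fin n) k →ₐ[k] MvPolynomial (Fin n) k :=
    aeval (fun i : Fin n => if i = b then X b + X a else (X i : MvPolynomial (Fin n) k)) with hτ
  have hψa : ψf (X a) = X a := by rw [hψf, aeval_X, if_neg hac]
  have hψb : ψf (X b) = X b := by rw [hψf, aeval_X, if_neg hbc]
  have hψc : ψf (X c) = X c - C (2⁻¹ : k) * (X b ^ 2 - X a * X b) := by rw [hψf, aeval_X, if_pos rfl]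
  have hψga : ψg (X a) = X a := by rw [hψg, aeval_X, if_neg hac]
  have hψgb : ψg (X b) = X b := by rw [hψg, aeval_X, if_neg hbc]
  have hψgc : ψg (X c) = X c + C (2⁻¹ : k) * (X b ^ 2 - X a * X b) := by
    rw [hψg, aeval_X, if_pos rfl]
  have hψC : ψf (C (2⁻¹ : k)) = C (2⁻¹ : k) := ψf.commutes (2⁻¹ : k)
  have hψgC : ψg (C (2⁻¹ : k)) = C (2⁻¹ : k) := ψg.commutes (2⁻¹ : k)
  -- `ψ ψ⁻¹ = id` and `ψ⁻¹ ψ = id`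
  have hfg : ∀ y, ψf (ψg y) = y := by
    have key : ψf.comp ψg = AlgHom.id k _ := by
      refine MvPolynomial.algHom_ext fun i => ?_
      change ψf (ψg (X i)) = X i
      by_cases hic : i = c
      · subst hic
        rw [hψgc, map_add, map_mul, map_sub, map_pow, map_mul, hψc, hψC, hψb, hψa]
        ring
      · rw [hψg, aeval_X, if_neg hic, hψf, aeval_X, if_neg hic]
    intro y
    exact congrArg (fun φ : MvPolynomial (Fin n) k →ₐ[k] MvPolynomial (Fin n) k => φ y) key
  have hgf : ∀ y, ψg (ψf y) = y := by
    have key : ψg.comp ψf = AlgHom.id k _ := by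
      refine MvPolynomial.algHom_ext fun i => ?_
      change ψg (ψf (X i)) = X i
      by_cases hic : i = c
      · subst hic
        rw [hψc, map_sub, map_mul, map_sub, map_pow, map_mul, hψgc, hψgC, hψgb, hψga]
        ring
      · rw [hψf, aeval_X, if_neg hic, hψg, aeval_X, if_neg hic]
    intro y
    exact congrArg (fun φ : MvPolynomial (Fin n) k →ₐ[k] MvPolynomial (Fin n) k => φ y) key
  -- `g = ψ⁻¹ f` is fixed by the translation
  have hτg : τ (ψg f) = ψg f := by
    have h1 : ψf (τ (ψg f)) = ψf (ψg f) := by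
      rw [hψf, hτ, rootChart_conj k n σU a b c hab hbc hac hb hc hσ h2, ← hψf, hfg, hf]
    have h2' := congrArg ψg h1
    rwa [hgf, hgf] at h2'
  have hg : ψg f ∈ Algebra.adjoin k (({X b ^ p - X a ^ (p - 1) * X b} :
      Set (MvPolynomial (Fin n) k)) ∪ ((fun i => X i) '' {i | i ≠ b})) :=
    mem_adjoin_of_translate_eq k n a b hab p hp (ψg f) hτg
  -- `f = ψ g ∈ ψ (k[N, xᵢ (i ≠ b)]) ≤ T`
  have hmap : Subalgebra.map ψf (Algebra.adjoin k (({X b ^ p - X a ^ (p - 1) * X b} :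
      Set (MvPolynomial (Fin n) k)) ∪ ((fun i => X i) '' {i | i ≠ b}))) ≤ T := by
    rw [AlgHom.map_adjoin, hT]
    refine Algebra.adjoin_le ?_
    rintro _ ⟨g, hg', rfl⟩
    rcases hg' with hg' | ⟨i, hib, rfl⟩
    · rw [Set.mem_singleton_iff] at hg'
      subst hg'
      rw [map_sub, map_pow, map_mul, map_pow, hψb, hψa]
      exact Algebra.subset_adjoin (Or.inl (Set.mem_insert _ _))
    · by_cases hic : i = c
      · subst hic
        change ψf (X i) ∈ _
        rw [hψc]
        exact Algebra.subset_adjoin (Or.inl (Set.mem_insert_of_mem _ (Set.mem_singleton _)))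
      · change ψf (X i) ∈ _
        rw [hψf, aeval_X, if_neg hic]
        exact Algebra.subset_adjoin (Or.inr ⟨i, ⟨hib, hic⟩, rfl⟩)
  rw [← hfg f]
  exact hmap (Subalgebra.mem_map.mpr ⟨ψg f, hg, rfl⟩)

end Summit.ResolutionOfSingularities.ResolutionOfSingularities.Theorems.WildQuotientResolution.ToricExit

end
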